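import Summits.QuantumFields.YangMills.Theorems.BalabanUVNodesN26SlopeOfRecord13
import Literature.MathematicalPhysics.QuantumFieldTheory.Balaban1983to89.Beta.StepDriftWitness

/-!
# Crux K2⁗ `EndpointGivenBR13Sep` — THE JETS OF ITS TWO REGISTERED STUBS ARE A FREE PARAMETRISATION: stub 1 `D1AtRecord13` ⟺ «the record's one-loop numbers
# `β⁰_θ` drift with a NON-NEGATIVE slope up to a bounded defect», and the registered PAIR at θ ⟺ the JETS-FREE PAIR «`OneLoopDrift d A β⁰_θ` with `0 ≤ d` ∧
# `AtSlopeCont (split₁₃ θ) γ₀ d`» — no `(Lc, Js, Nc)`, no composite jets, no `Residue` left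

Cell `pub-ymgap`, YM-PLAN Track A (HUMAN RULING D-0062), seat `pub-ymgap-dag-n26-c` gen 8 (R134 acceleration seat, s2; K2 lane per dag-lead WORDS-140); helper for crux K2⁗
`EndpointGivenBR13Sep` = stmt-QuantumFields-20291 (route `BalabanUVNodes` rev 18∕19; plan g67's registered skeleton `D67-REV18/K2Skeleton13Sep.lean` sha16 f65d6d28302ea0ea:
`stub_d1Residue13 : D1AtRecord13` — at every admissible θ with separated-range provisos SOME datum `(Lc, Js, Nc)` of step jets whose typed step kernels' `(0,1)` second moments ARE
the record's one-loop numbers (the pin) with cell pub-balaban-gaps' `Gaps.D1Residue.Residue Lc Js Nc 0 1`; `stub_d4AtSlopeCont13 : D4AtSlopeOfD1Record13` — for EVERY such datum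
`AtSlopeCont (split₁₃ θ) γ₀ (stepBal Nc Lc)` on some box).  This lineage's p502604 (`…N26SlopeOfRecord13`) showed that stub 2 reads ONE slope per θ (the record's one-loop Cesàro
drift).  Here the (D1) side is finished off: the β-function sub-cell's `Beta.StepDriftWitness` (strat-b12 gen 10: «EVERY real sequence is realised as the sequence of (μ, ν) second
moments of the typed step kernels of SOME jet data», `exists_jetData_secondMoment_eq`) has a one-shot twin (§1, the same matrix-unit witness read through `OneStepResolventKernel.TOf`),
so the composite jets of `Residue` are freely realisable too (§2 `residue_of_oneLoopDrift`, `residue_iff_d1Drift`): the pin + residue of stub 1 cost EXACTLY a non-negative-slope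
`OneLoopDrift` of the numbers pinned on (§2 `exists_datum_of_oneLoopDrift_nonneg`).

WHAT IS HERE (0 `def`, 0 `sorry`; [folklore] algebra over the typed jet objects + three-line compositions):
* §1 THE ONE-SHOT PRESCRIBED-MOMENT WITNESS (any dimension `d`, blocking `N`): `vertexOf_zeroStencil`, `TOf_jetW` (the typed one-shot kernel of `StepDriftWitness.jetW N Q zs κ c` is
  supported at `zs` with value `½·c·KInv Q 0 (inl κ) (inr κ)`), `exists_KInv_inl_inr_ne_zero` (the packed resolvent's field–multiplier block is not zero: `KernelSpecInstance.wH_Q`,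
  «𝒬ℋ = 1», summed over one block), `secondMoment_TOf_jetW`, `exists_jetData_secondMoment_TOf_eq` (PRESCRIBED one-shot moment), `exists_jetData_secondMoment_TshotOf_eq` (`d + 1 = 4`:
  every real sequence is the sequence of `(μ, ν)` second moments of `TshotOf Lc Jc m` for SOME composite jet family `Jc`).
* §2 `atSlopeCont_mono_slope` (the rows-(D4) ∧ B4 residue is monotone in the slope: only the seam inequality reads it), `residue_of_oneLoopDrift` (a drift of the step moments with slope `stepBal Nc Lc` ⟹ `Residue Lc Js Nc μ ν`: cook `Jc` with one-shot moments `m·stepBal Nc Lc` — `OneShotLaw` with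
  `U = 0`, `ReadoutBdd` = the drift), `residue_iff_d1Drift` (`Residue ⟺ D1Drift`: the composite jets of g1-p1's residue are eliminable), ★ `exists_datum_of_oneLoopDrift_nonneg` (ANY real
  sequence `β0` with `OneLoopDrift d A β0`, `0 ≤ d` IS the pinned step-moment sequence of some datum `(Lc, Js, Nc) := (2, jetW…, √(12π²d∕(11 log 2)))` with its residue, any channel).
* §3 AT THE STAGE-13 RECORD (general `N`, θ): `exists_datum₁₃_iff_oneLoopDrift_nonneg` («a (D1) datum exists at θ» ⟺ «`∃ d A, 0 ≤ d ∧ OneLoopDrift d A β⁰_θ`»), ★★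
  `registeredPair₁₃_iff_jetsFreePair` («(∃ datum) ∧ (∀ datum, ∃ γ₀ ∈ ]0, θ.γ], AtSlopeCont (split₁₃ θ) γ₀ (stepBal Nc Lc))» ⟺ «∃ d A, 0 ≤ d ∧ OneLoopDrift d A β⁰_θ ∧ ∃ γ₀ ∈ ]0, θ.γ],
  AtSlopeCont (split₁₃ θ) γ₀ d» — K2⁗'s two registered stubs, jointly at θ, say EXACTLY: the record's one-loop numbers drift with some slope `d ≥ 0` and the rows-(D4) ∧ B4 residue holds
  at `d`; `Gaps.D1Residue.oneLoopDrift_slope_unique` for ⇐), `registeredPair₁₃_of_drift_atSlopeCont_le` (USE form: a non-negative drift `d` + the residue at ANY slope `s ≤ d` ⟹ the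
  registered pair at θ — with (D1) in print's letters the (D4) payer may aim at any `L`-free slope `s ≤ stepBal N 2`).
* §4 `d1AtRecord13Sep_iff_oneLoopDrift_nonneg`: the registered stub-1 text `K2Skeleton13Sep.D1AtRecord13` (spelled VERBATIM, `N = 2`; the skeleton is not a tree module) ⟺ «∀ F θ hP hθ,
  ∃ d A, 0 ≤ d ∧ OneLoopDrift d A β⁰_θ».

HONEST FRAMING.  A SATISFIABILITY∕ELIMINATION certificate about the TYPED objects (which jet data are quantified: ANY — the registered stubs existentially quantify the jets, so they pin
nothing of Bałaban's stencils `JsBal`; the (D1) lane's printed content — the one-shot law FOR BAŁABAN's STENCILS, [I] (2.12)–(2.13) — enters K2⁗ only through the drift of the record's own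
`β⁰_θ`); nothing of Bałaban's analysis is asserted; `stub_d1Residue13` ∕ `stub_d4AtSlopeCont13` ∕ K2⁗ NOT proved (both sides of every ⟺ unproved: the record's `β⁰_θ` are `limUnder`
objects, instance 0∕1); N25 ∕ N26 NOT discharged; counts unmoved (5∕27 · A 5∕28); count-neutral; one finite four-torus programme at fixed ε per run — NOT the continuum limit, NOT ℝ⁴, NOT OS,
NOT a mass gap, NOT Clay.  No `instance`, no `notation`, no `axiom`.
Sources (context): [I] = [Balaban1987RG1] CMP **109** (1987): Thm 2 p. 259 (first sentence), (1.20)–(1.22) p. 264, (2.12)–(2.14) p. 268; [II] = [Balaban1988RG2Cluster] CMP **116** (1988):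
Lemma 3 (2.38) p. 20; [Balaban1984PropagatorsI] CMP **95** (1984): p. 20 (1.16)–(1.18) (block averaging, orientation only).
-/

noncomputable section

open scoped Matrix.Norms.L2Operator

namespace Summit.QuantumFields.YangMills.Theorems.BalabanUVNodesK2D1StubJetsFree

open Finset
open scoped BigOperators
open Literature.MathematicalPhysics.QuantumFieldTheory.Balaban1983to89
open Literature.MathematicalPhysics.QuantumFieldTheory.Balaban1983to89.FlowStep
open Literature.MathematicalPhysics.QuantumFieldTheory.Balaban1983to89.T4Continuum (T4Family)
open Literature.MathematicalPhysics.QuantumFieldTheory.Balaban1983to89.Node00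
open Literature.MathematicalPhysics.QuantumFieldTheory.Balaban1983to89.Beta
open Literature.MathematicalPhysics.QuantumFieldTheory.Balaban1983to89.B12Beta (secondMoment)
open Literature.MathematicalPhysics.QuantumFieldTheory.Balaban1983to89.Beta.AffineAveraging (toSite unitVec contourSum)
open Literature.MathematicalPhysics.QuantumFieldTheory.Balaban1983to89.Beta.KernelSpecInstance (wH wH_Q)
open Literature.MathematicalPhysics.QuantumFieldTheory.Balaban1983to89.Beta.ExpKernelCalculus (MKer hessKer tadpole bubble)
open Literature.MathematicalPhysics.QuantumFieldTheory.Balaban1983to89.Beta.OneStepResolventKernel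
  (Fib KInv KInv_inl_inr_coarse wsum JetData TOf vertexOf)
open Literature.MathematicalPhysics.QuantumFieldTheory.Balaban1983to89.Beta.Drift (OneLoopDrift)
open Literature.MathematicalPhysics.QuantumFieldTheory.Balaban1983to89.Beta.OneStepKernelFamily (TbalOf TshotOf D1Drift)
open Literature.MathematicalPhysics.QuantumFieldTheory.Balaban1983to89.Beta.StepDriftWitness
  (zeroStencil unitW jetW zstar zstar_cast_ne_zero tadpole_smul_unitKer tadpole_zero bubble_zero exists_jetData_secondMoment_eq)
open Summit.QuantumFields.BalabanUV.Gaps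
open Summit.QuantumFields.BalabanUV.Gaps.BetaContFromD4Chain
open Summit.QuantumFields.BalabanUV.Gaps.D1Residue (Residue ReadoutBdd OneShotLaw d1Drift_of_residue oneLoopDrift_slope_unique)
open Summit.QuantumFields.YangMills.Theorems.BalabanUVNodesN26SlopeOfRecord13 (stepBal_natCast_nonneg)
open Filter Topology

/-! ## §1 The one-shot prescribed-moment witness: `StepDriftWitness.jetW` read through `OneStepResolventKernel.TOf` -/

section OneShotWitness

variable {d : ℕ} {N : ℕ} [NeZero N]

/-- The chain-rule vertex of the ZERO stencil is zero (twin of `StepDriftWitness.vertexOfK_zeroStencil` for `OneStepResolventKernel.vertexOf`). [folklore] -/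
theorem vertexOf_zeroStencil : vertexOf (N := N) (zeroStencil d) = fun _ _ => 0 := by
  funext μ y x z a b
  simp only [vertexOf, wsum, zeroStencil, Pi.zero_apply, mul_zero, tsum_zero, Finset.sum_const_zero]

/-- **THE TYPED ONE-SHOT KERNEL OF THE WITNESS DATUM** (blocking `N`) is supported at the single point `zs`, with the value `½ · c · KInv Q 0 (inl κ) (inr κ)`: zero
first-order vertex ⟹ no bubble; the tadpole reads one entry of the packed resolvent (twin of `StepDriftWitness.TstepOf_jetW`). [folklore] -/
theorem TOf_jetW (Q zs : Fin (d + 1) → ℤ) (κ : Fin (d + 1)) (c : ℝ) (μ ν : Fin (d + 1)) (z : Fin (d + 1) → ℤ) :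
    TOf (N := N) (jetW N Q zs κ c) μ ν z = if z = zs then 1 / 2 * (c * KInv (N := N) (d := d) Q 0 (Sum.inl κ) (Sum.inr κ)) else 0 := by
  simp only [TOf, jetW, vertexOf_zeroStencil, hessKer, bubble_zero, mul_zero, sub_zero, unitW, true_and]
  split_ifs with h
  · rw [tadpole_smul_unitKer]
  · rw [tadpole_zero, mul_zero]

/-- **THE PACKED RESOLVENT's FIELD–MULTIPLIER BLOCK IS NOT ZERO**: some entry `KInv x 0 (inl κ) (inr κ)` is non-zero — its block-contour sum is `𝒬ℋ = 1`
(`KernelSpecInstance.wH_Q` with `OneStepResolventKernel.KInv_inl_inr_coarse`). [folklore] -/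
theorem exists_KInv_inl_inr_ne_zero (κ : Fin (d + 1)) : ∃ x : Fin (d + 1) → ℤ, KInv (N := N) (d := d) x 0 (Sum.inl κ) (Sum.inr κ) ≠ 0 := by
  by_contra h
  push Not at h
  have hw : ∀ x : Fin (d + 1) → ℤ, wH (N := N) κ κ x = 0 := fun x => by
    have e := KInv_inl_inr_coarse (N := N) (d := d) κ κ x 0
    rw [smul_zero, sub_zero] at e
    rw [← e]
    exact h x
  have hQ := wH_Q (N := N) κ κ (0 : AffineAveraging.Site (d + 1))
  simp only [and_self, if_true, contourSum, hw, Finset.sum_const_zero] at hQ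
  exact zero_ne_one hQ

/-- **THE (μ,ν) SECOND MOMENT OF THE WITNESS ONE-SHOT KERNEL** with support point `z⋆ = e_μ + e_ν`: `½ · c · KInv Q 0 (inl κ) (inr κ) · z⋆_μ z⋆_ν`. [folklore] -/
theorem secondMoment_TOf_jetW (Q : Fin (d + 1) → ℤ) (κ : Fin (d + 1)) (c : ℝ) (μ ν : Fin (d + 1)) :
    secondMoment (TOf (N := N) (jetW N Q (zstar μ ν) κ c)) μ ν =
      1 / 2 * (c * KInv (N := N) (d := d) Q 0 (Sum.inl κ) (Sum.inr κ)) * ((zstar μ ν μ : ℤ) : ℝ) * ((zstar μ ν ν : ℤ) : ℝ) := by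
  simp only [secondMoment, TOf_jetW]
  rw [tsum_eq_single (zstar μ ν)]
  · rw [if_pos rfl]
  · intro z hz
    simp only [hz, if_false, zero_mul]

/-- **PRESCRIBED ONE-SHOT MOMENT** (any dimension, any blocking `N`): for every real `t` and channel `(μ, ν)` there is a jet datum whose typed one-shot kernel `TOf J` has `(μ, ν)`
second moment EXACTLY `t` — scale the matrix unit at a non-zero field–multiplier entry of `KInv`. [folklore] -/
theorem exists_jetData_secondMoment_TOf_eq (t : ℝ) (μ ν : Fin (d + 1)) : ∃ J : JetData d N, secondMoment (TOf (N := N) J) μ ν = t := by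
  classical
  obtain ⟨Q, hQ⟩ := exists_KInv_inl_inr_ne_zero (N := N) (d := d) μ
  obtain ⟨hμ, hν⟩ := zstar_cast_ne_zero (d := d) μ ν
  refine ⟨jetW N Q (zstar μ ν) μ (2 * t / (KInv (N := N) (d := d) Q 0 (Sum.inl μ) (Sum.inr μ) * (((zstar μ ν μ : ℤ) : ℝ) * ((zstar μ ν ν : ℤ) : ℝ)))), ?_⟩
  rw [secondMoment_TOf_jetW]
  field_simp

/-- **PRESCRIBED ONE-SHOT MOMENTS IN DIMENSION FOUR** for the one-shot family `TshotOf Lc Jc m = TOf (N := Lc^m) (Jc m)`: every real sequence is the sequence of `(μ, ν)` second moments of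
the typed one-shot kernels of SOME composite jet family. [folklore] -/
theorem exists_jetData_secondMoment_TshotOf_eq {Lc : ℕ} [NeZero Lc] (t : ℕ → ℝ) (μ ν : Fin 4) :
    ∃ Jc : ∀ m : ℕ, JetData 3 (Lc ^ m), ∀ m, secondMoment (TshotOf Lc Jc m) μ ν = t m := by
  have hex := fun m => exists_jetData_secondMoment_TOf_eq (N := Lc ^ m) (d := 3) (t m) μ ν
  choose Jc hJc using hex
  exact ⟨Jc, fun m => hJc m⟩

end OneShotWitness

/-! ## §2 The composite jets of the residue are eliminable: `Residue ⟺ D1Drift`; any non-negative-slope drift is realised by a datum -/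

section ResidueFree

/-- **`AtSlopeCont` IS MONOTONE IN THE SLOPE**: the slope enters the rows-(D4) ∧ B4 residue only through the seam inequality `ε₁ · K_rem,L ≤ s`, so a residue at slope `s` is one at every
`s' ≥ s` (same chain, same box, same records). [cite: Balaban1988RG2Cluster, Lemma 3 (2.38) p.20 (bookkeeping)] -/
theorem atSlopeCont_mono_slope {β : HBeta} {Sβ : B12Beta.OneLoopSplit β} {γ₀ s s' : ℝ} (hss' : s ≤ s') (h : AtSlopeCont Sβ γ₀ s) :
    AtSlopeCont Sβ γ₀ s' := by
  obtain ⟨M, inst, μ, ν, c, ℓ, α₂, q, R, hcpt, hC, h22, hq, hs, hε⟩ := h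
  exact ⟨M, inst, μ, ν, c, ℓ, α₂, q, R, hcpt, hC, h22, hq, hs, hε.trans hss'⟩

variable {Lc : ℕ} [NeZero Lc]

/-- **A DRIFT OF THE STEP MOMENTS GIVES THE RESIDUE** (composite jets cooked): `OneLoopDrift (stepBal Nc Lc) A (secondMoment ∘ TbalOf Lc Js)` ⟹ `Residue Lc Js Nc μ ν` — take the composite
family `Jc` with one-shot moments EXACTLY `m · stepBal Nc Lc` (§1); then `OneShotLaw` holds with `U = 0` and `ReadoutBdd` IS the drift. [folklore] -/
theorem residue_of_oneLoopDrift (Js : ℕ → JetData 3 Lc) {Nc : ℝ} {μ ν : Fin 4} {A : ℝ}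
    (h : OneLoopDrift (B12Normalization.stepBal Nc Lc) A (fun j => secondMoment (TbalOf Lc Js j) μ ν)) : Residue Lc Js Nc μ ν := by
  obtain ⟨Jc, hJc⟩ := exists_jetData_secondMoment_TshotOf_eq (Lc := Lc) (fun m => B12Normalization.stepBal Nc Lc * m) μ ν
  refine ⟨Jc, ⟨A, fun m _ => ?_⟩, ⟨0, fun m _ => ?_⟩⟩
  · rw [hJc]
    exact h m
  · rw [hJc, sub_self, abs_zero]

/-- **`Residue ⟺ D1Drift`** over the typed objects: g1-p1's residue (some composite family telescopes in `O(1)` AND obeys the one-shot law) holds for the step jets `Js` iff their moments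
drift with slope `stepBal Nc Lc` — the composite jets are a free parametrisation (`Gaps.D1Residue.d1Drift_of_residue`; §2). [folklore] -/
theorem residue_iff_d1Drift (Js : ℕ → JetData 3 Lc) (Nc : ℝ) (μ ν : Fin 4) : Residue Lc Js Nc μ ν ↔ D1Drift Lc Js Nc μ ν :=
  ⟨d1Drift_of_residue Js, fun ⟨_, hA⟩ => residue_of_oneLoopDrift Js hA⟩

omit [NeZero Lc] in
/-- **★ ANY NON-NEGATIVE-SLOPE DRIFT IS A (D1) DATUM**: a real sequence `β0` with `OneLoopDrift d A β0`, `0 ≤ d`, IS the sequence of pinned `(μ, ν)` step second moments of some datum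
`(Lc, Js, Nc)` with its residue — block `Lc := 2`, step jets from `Beta.StepDriftWitness.exists_jetData_secondMoment_eq`, colour numeral `Nc := √(12π²d ∕ (11·log 2))` (so that
`stepBal Nc 2 = d`), composite jets by §2.  The jets are nobody's stencils: a satisfiability certificate. [folklore] -/
theorem exists_datum_of_oneLoopDrift_nonneg {β0 : ℕ → ℝ} {d A : ℝ} (hd : 0 ≤ d) (h : OneLoopDrift d A β0) (μ ν : Fin 4) :
    ∃ (Lc : ℕ) (_ : NeZero Lc) (Js : ℕ → JetData 3 Lc) (Nc : ℝ),
      (∀ j, β0 j = secondMoment (TbalOf Lc Js j) μ ν) ∧ Residue Lc Js Nc μ ν := by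
  obtain ⟨Js, hJs⟩ := exists_jetData_secondMoment_eq (Lc := 2) β0 μ ν
  have hlog : 0 < Real.log 2 := Real.log_pos (by norm_num)
  have hX : 0 ≤ d * (12 * Real.pi ^ 2) / (11 * Real.log 2) :=
    div_nonneg (mul_nonneg hd (by positivity)) (mul_nonneg (by norm_num) hlog.le)
  have hs : B12Normalization.stepBal (Real.sqrt (d * (12 * Real.pi ^ 2) / (11 * Real.log 2))) ((2 : ℕ) : ℝ) = d := by
    rw [B12Normalization.stepBal_eq, Real.sq_sqrt hX, Nat.cast_ofNat]
    field_simp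
  refine ⟨2, inferInstance, Js, Real.sqrt (d * (12 * Real.pi ^ 2) / (11 * Real.log 2)), fun j => (hJs j).symm,
    residue_of_oneLoopDrift (A := A) Js ?_⟩
  rw [hs, show (fun j => secondMoment (TbalOf 2 Js j) μ ν) = β0 from funext hJs]
  exact h

end ResidueFree

variable (F : T4Family) (N : ℕ) [NeZero N]

/-! ## §3 At the Stage-13 record: a datum exists ⟺ the record's `β⁰` drifts with a non-negative slope; the REGISTERED PAIR ⟺ the JETS-FREE PAIR -/

section AtRecord

variable (θ : Stage13Params F N)

/-- **A (D1) DATUM EXISTS AT θ ⟺ THE RECORD's ONE-LOOP NUMBERS DRIFT WITH A NON-NEGATIVE SLOPE** (bounded defect): the pin + residue of K2⁗'s stub 1 at `(F, N, θ)` cost EXACTLY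
`∃ d A, 0 ≤ d ∧ OneLoopDrift d A β⁰_θ`, `β⁰_θ = beta0OfMerged β_m θ.v₀` (⇒ `Gaps.D1Residue.d1Drift_of_residue` along the pin, `stepBal ≥ 0`; ⇐ §2). [cite: Balaban1987RG1, (2.12)–(2.13) p.268 and (1.22) p.264] -/
theorem exists_datum₁₃_iff_oneLoopDrift_nonneg :
    (letI := θ.instVβ₁; letI := θ.instVβ₂; letI := θ.instιβ
      ∃ (Lc : ℕ) (_ : NeZero Lc) (Js : ℕ → JetData 3 Lc) (Nc : ℝ),
        (∀ j, beta0OfMerged (betaMerged F (mergedTermFamilyMatT F N (TcanOfRecord F N) (chiFixed29 F N θ.ν θ.ε₂₉) θ.εbg) θ.ρ8 θ.bV) θ.v₀ j =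
          secondMoment (TbalOf Lc Js j) 0 1) ∧
        Residue Lc Js Nc 0 1) ↔
    (letI := θ.instVβ₁; letI := θ.instVβ₂; letI := θ.instιβ
      ∃ d A : ℝ, 0 ≤ d ∧ OneLoopDrift d A
        (beta0OfMerged (betaMerged F (mergedTermFamilyMatT F N (TcanOfRecord F N) (chiFixed29 F N θ.ν θ.ε₂₉) θ.εbg) θ.ρ8 θ.bV) θ.v₀)) := by
  constructor
  · rintro ⟨Lc, _, Js, Nc, hβ, hres⟩
    obtain ⟨A, hA⟩ := d1Drift_of_residue Js hres
    have e : (fun j => secondMoment (TbalOf Lc Js j) 0 1) =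
        (letI := θ.instVβ₁; letI := θ.instVβ₂; letI := θ.instιβ
         beta0OfMerged (betaMerged F (mergedTermFamilyMatT F N (TcanOfRecord F N) (chiFixed29 F N θ.ν θ.ε₂₉) θ.εbg) θ.ρ8 θ.bV) θ.v₀) :=
      funext fun j => (hβ j).symm
    rw [e] at hA
    exact ⟨_, A, stepBal_natCast_nonneg Nc Lc, hA⟩
  · rintro ⟨d, A, hd, h⟩
    exact exists_datum_of_oneLoopDrift_nonneg hd h 0 1

/-- **★★ K2⁗'s TWO REGISTERED STUBS, JOINTLY AT θ, SAY EXACTLY: «the record's one-loop numbers drift with some slope `d ≥ 0` AND the rows-(D4) ∧ B4 residue `AtSlopeCont` of the record's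
split holds at `d` on a box `0 < γ₀ ≤ θ.γ`»** — the registered pair «(∃ datum) ∧ (∀ datum, `∃ γ₀ ∈ ]0, θ.γ], AtSlopeCont (split₁₃ θ) γ₀ (stepBal Nc Lc)`)» ⟺ the jets-free pair; no `(Lc, Js, Nc)`,
no composite jets, no `Residue` (⇒: a datum's slope IS a drift slope of `β⁰_θ`; ⇐: §2's datum, and every datum's slope equals `d` by `Gaps.D1Residue.oneLoopDrift_slope_unique`).  The jets-free
pair is what NODE O ∕ the (D1) ∕ (D4) lanes owe at θ; ym-nodeO-ideate P3 EVIDENCE-54 v3's `DDrift13P` is its `∃ γ₀`-form. [cite: Balaban1987RG1, Thm 2 p.259 (first sentence), (1.20)–(1.22) p.264 and (2.12)–(2.14) p.268; Balaban1988RG2Cluster, Lemma 3 (2.38) p.20] -/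
theorem registeredPair₁₃_iff_jetsFreePair :
    (letI := θ.instVβ₁; letI := θ.instVβ₂; letI := θ.instιβ
      (∃ (Lc : ℕ) (_ : NeZero Lc) (Js : ℕ → JetData 3 Lc) (Nc : ℝ),
        (∀ j, beta0OfMerged (betaMerged F (mergedTermFamilyMatT F N (TcanOfRecord F N) (chiFixed29 F N θ.ν θ.ε₂₉) θ.εbg) θ.ρ8 θ.bV) θ.v₀ j =
          secondMoment (TbalOf Lc Js j) 0 1) ∧
        Residue Lc Js Nc 0 1) ∧
      (∀ (Lc : ℕ) (_ : NeZero Lc) (Js : ℕ → JetData 3 Lc) (Nc : ℝ),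
        (∀ j, beta0OfMerged (betaMerged F (mergedTermFamilyMatT F N (TcanOfRecord F N) (chiFixed29 F N θ.ν θ.ε₂₉) θ.εbg) θ.ρ8 θ.bV) θ.v₀ j =
            secondMoment (TbalOf Lc Js j) 0 1) →
        Residue Lc Js Nc 0 1 →
        ∃ γ₀ : ℝ, 0 < γ₀ ∧ γ₀ ≤ θ.γ ∧
          AtSlopeCont
            (oneLoopSplit_betaOfMerged (betaMerged F (mergedTermFamilyMatT F N (TcanOfRecord F N) (chiFixed29 F N θ.ν θ.ε₂₉) θ.εbg) θ.ρ8 θ.bV)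
              (beta0OfMerged (betaMerged F (mergedTermFamilyMatT F N (TcanOfRecord F N) (chiFixed29 F N θ.ν θ.ε₂₉) θ.εbg) θ.ρ8 θ.bV) θ.v₀) θ.γ)
            γ₀ (B12Normalization.stepBal Nc Lc))) ↔
    (letI := θ.instVβ₁; letI := θ.instVβ₂; letI := θ.instιβ
      ∃ d A : ℝ, 0 ≤ d ∧
        OneLoopDrift d A (beta0OfMerged (betaMerged F (mergedTermFamilyMatT F N (TcanOfRecord F N) (chiFixed29 F N θ.ν θ.ε₂₉) θ.εbg) θ.ρ8 θ.bV) θ.v₀) ∧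
        ∃ γ₀ : ℝ, 0 < γ₀ ∧ γ₀ ≤ θ.γ ∧
          AtSlopeCont
            (oneLoopSplit_betaOfMerged (betaMerged F (mergedTermFamilyMatT F N (TcanOfRecord F N) (chiFixed29 F N θ.ν θ.ε₂₉) θ.εbg) θ.ρ8 θ.bV)
              (beta0OfMerged (betaMerged F (mergedTermFamilyMatT F N (TcanOfRecord F N) (chiFixed29 F N θ.ν θ.ε₂₉) θ.εbg) θ.ρ8 θ.bV) θ.v₀) θ.γ)
            γ₀ d) := by
  constructor
  · rintro ⟨⟨Lc, inst, Js, Nc, hβ, hres⟩, hall⟩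
    obtain ⟨A, hA⟩ := d1Drift_of_residue Js hres
    have e : (fun j => secondMoment (TbalOf Lc Js j) 0 1) =
        (letI := θ.instVβ₁; letI := θ.instVβ₂; letI := θ.instιβ
         beta0OfMerged (betaMerged F (mergedTermFamilyMatT F N (TcanOfRecord F N) (chiFixed29 F N θ.ν θ.ε₂₉) θ.εbg) θ.ρ8 θ.bV) θ.v₀) :=
      funext fun j => (hβ j).symm
    rw [e] at hA
    exact ⟨_, A, stepBal_natCast_nonneg Nc Lc, hA, hall Lc inst Js Nc hβ hres⟩
  · rintro ⟨d, A, hd, h, γ₀, hγ₀, hle, hres⟩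
    refine ⟨exists_datum_of_oneLoopDrift_nonneg hd h 0 1, fun Lc inst Js Nc hβ hres' => ⟨γ₀, hγ₀, hle, ?_⟩⟩
    obtain ⟨A', hA'⟩ := d1Drift_of_residue Js hres'
    have e : (fun j => secondMoment (TbalOf Lc Js j) 0 1) =
        (letI := θ.instVβ₁; letI := θ.instVβ₂; letI := θ.instιβ
         beta0OfMerged (betaMerged F (mergedTermFamilyMatT F N (TcanOfRecord F N) (chiFixed29 F N θ.ν θ.ε₂₉) θ.εbg) θ.ρ8 θ.bV) θ.v₀) :=
      funext fun j => (hβ j).symm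
    rw [e] at hA'
    rw [oneLoopDrift_slope_unique hA' h]
    exact hres

/-- **USE FORM — THE REGISTERED PAIR AT θ FROM A NON-NEGATIVE DRIFT AND THE RESIDUE AT ANY SLOPE BELOW IT**: `OneLoopDrift d A β⁰_θ` with `0 ≤ d`, a box `0 < γ₀ ≤ θ.γ` and
`AtSlopeCont (split₁₃ θ) γ₀ s` at SOME `s ≤ d` ⟹ both registered stubs' bodies at θ (§3 ⇐ with `atSlopeCont_mono_slope`) — e.g. with row (D1) in print's letters `d = stepBal N F.L` and the
(D4) payer may aim at any `L`-free slope `s ≤ stepBal N 2` (p502604 §5).  Instance 0∕1. [cite: Balaban1987RG1, (1.20)–(1.22) p.264 and (2.12)–(2.13) p.268; Balaban1988RG2Cluster, Lemma 3 (2.38) p.20] -/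
theorem registeredPair₁₃_of_drift_atSlopeCont_le {d A γ₀ s : ℝ} (hd : 0 ≤ d)
    (h : letI := θ.instVβ₁; letI := θ.instVβ₂; letI := θ.instιβ
      OneLoopDrift d A (beta0OfMerged (betaMerged F (mergedTermFamilyMatT F N (TcanOfRecord F N) (chiFixed29 F N θ.ν θ.ε₂₉) θ.εbg) θ.ρ8 θ.bV) θ.v₀))
    (hγ₀ : 0 < γ₀) (hle : γ₀ ≤ θ.γ) (hsd : s ≤ d)
    (hres : letI := θ.instVβ₁; letI := θ.instVβ₂; letI := θ.instιβ
      AtSlopeCont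
        (oneLoopSplit_betaOfMerged (betaMerged F (mergedTermFamilyMatT F N (TcanOfRecord F N) (chiFixed29 F N θ.ν θ.ε₂₉) θ.εbg) θ.ρ8 θ.bV)
          (beta0OfMerged (betaMerged F (mergedTermFamilyMatT F N (TcanOfRecord F N) (chiFixed29 F N θ.ν θ.ε₂₉) θ.εbg) θ.ρ8 θ.bV) θ.v₀) θ.γ)
        γ₀ s) :
    letI := θ.instVβ₁; letI := θ.instVβ₂; letI := θ.instιβ
    (∃ (Lc : ℕ) (_ : NeZero Lc) (Js : ℕ → JetData 3 Lc) (Nc : ℝ),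
      (∀ j, beta0OfMerged (betaMerged F (mergedTermFamilyMatT F N (TcanOfRecord F N) (chiFixed29 F N θ.ν θ.ε₂₉) θ.εbg) θ.ρ8 θ.bV) θ.v₀ j =
        secondMoment (TbalOf Lc Js j) 0 1) ∧
      Residue Lc Js Nc 0 1) ∧
    (∀ (Lc : ℕ) (_ : NeZero Lc) (Js : ℕ → JetData 3 Lc) (Nc : ℝ),
      (∀ j, beta0OfMerged (betaMerged F (mergedTermFamilyMatT F N (TcanOfRecord F N) (chiFixed29 F N θ.ν θ.ε₂₉) θ.εbg) θ.ρ8 θ.bV) θ.v₀ j =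
          secondMoment (TbalOf Lc Js j) 0 1) →
      Residue Lc Js Nc 0 1 →
      ∃ γ₀ : ℝ, 0 < γ₀ ∧ γ₀ ≤ θ.γ ∧
        AtSlopeCont
          (oneLoopSplit_betaOfMerged (betaMerged F (mergedTermFamilyMatT F N (TcanOfRecord F N) (chiFixed29 F N θ.ν θ.ε₂₉) θ.εbg) θ.ρ8 θ.bV)
            (beta0OfMerged (betaMerged F (mergedTermFamilyMatT F N (TcanOfRecord F N) (chiFixed29 F N θ.ν θ.ε₂₉) θ.εbg) θ.ρ8 θ.bV) θ.v₀) θ.γ)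
          γ₀ (B12Normalization.stepBal Nc Lc)) :=
  (registeredPair₁₃_iff_jetsFreePair F N θ).2 ⟨d, A, hd, h, γ₀, hγ₀, hle, atSlopeCont_mono_slope hsd hres⟩

end AtRecord

/-! ## §4 Crux K2⁗'s registered stub 1 `D1AtRecord13` (text verbatim, `N = 2`) ⟺ «at every admissible θ with separated-range provisos the record's `β⁰` drifts with a slope `≥ 0`» -/

section Stub

/-- **`K2Skeleton13Sep.D1AtRecord13` (plan g67's registered stub-1 text, VERBATIM; `N = 2`) ⟺ ITS JETS-FREE FORM** «∀ F θ (hP : θ.Provisos₁₃Sep F 2), θ.Admissible F 2 →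
∃ d A, 0 ≤ d ∧ OneLoopDrift d A β⁰_θ»: the (D1) stub of crux K2⁗ asserts of the record exactly a non-negative-slope drift (bounded defect) of its one-loop numbers — the step jets, the colour
numeral, the block and the composite jets of `Residue` are freely realisable (§2∕§3).  Neither side proved (instance 0∕1). [cite: Balaban1987RG1, (2.12)–(2.13) p.268 and (1.22) p.264] -/
theorem d1AtRecord13Sep_iff_oneLoopDrift_nonneg :
    (∀ (F : T4Family) (θ : Stage13Params F 2) (hP : θ.Provisos₁₃Sep F 2), θ.Admissible F 2 →
      letI := θ.instVβ₁; letI := θ.instVβ₂; letI := θ.instιβ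
      ∃ (Lc : ℕ) (_ : NeZero Lc) (Js : ℕ → JetData 3 Lc) (Nc : ℝ),
        (∀ j, beta0OfMerged (betaMerged F (mergedTermFamilyMatT F 2 (TcanOfRecord F 2) (chiFixed29 F 2 θ.ν θ.ε₂₉) θ.εbg) θ.ρ8 θ.bV) θ.v₀ j =
            B12Beta.secondMoment (TbalOf Lc Js j) 0 1) ∧
        D1Residue.Residue Lc Js Nc 0 1) ↔
    (∀ (F : T4Family) (θ : Stage13Params F 2) (hP : θ.Provisos₁₃Sep F 2), θ.Admissible F 2 →
      letI := θ.instVβ₁; letI := θ.instVβ₂; letI := θ.instιβ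
      ∃ d A : ℝ, 0 ≤ d ∧
        OneLoopDrift d A (beta0OfMerged (betaMerged F (mergedTermFamilyMatT F 2 (TcanOfRecord F 2) (chiFixed29 F 2 θ.ν θ.ε₂₉) θ.εbg) θ.ρ8 θ.bV) θ.v₀)) := by
  constructor
  · intro h F θ hP hθ
    exact (exists_datum₁₃_iff_oneLoopDrift_nonneg F 2 θ).1 (h F θ hP hθ)
  · intro h F θ hP hθ
    exact (exists_datum₁₃_iff_oneLoopDrift_nonneg F 2 θ).2 (h F θ hP hθ)

end Stub

end Summit.QuantumFields.YangMills.Theorems.BalabanUVNodesK2D1StubJetsFree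

end
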